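import Summits.PneNP.PneNP.Theorems.SzkEntropyPeaWorstToAvgDualModeCompileAdviceElimExperiment
import Literature.Computability.MetaComplexity.SchemeEncBricks

/-!
# Route SzkEntropy, crux `PeaWorstToAvg` (stmt-PneNP-10777), line `dual-mode-compile`, stub `stub_adviceElim`:
# the bricks of the uniform scheme (I): counted sums of one-bit pieces, the majority vote of a candidate

Support file (4) for the stub `stub_adviceElim` (advice elimination by labelled self-testing): the first
half of the uniform scheme `U` as a total `FP` string function in the brick algebra of
`Complexity/BrickAlgebra.lean` / `FoldBricks.lean` (records `⟨x, ⟨cnt, ⟨1ⁱ, acc⟩⟩⟩`, the counted fold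
`Brick.foldLoop`, its model `Brick.foldAcc`):

* `sumF f kF p` — **the counted sum** `x ↦ bin (Σ_{j < |kF x|} ⟦f ⟨x, 1ʲ⟩⟧)` of the values of a piece
  function over a unary-counted range (`foldLoop addFn`, `foldAcc_addFn`), with `sumF_apply` and
  `sumF_mem_FP` (piece of linear growth in its first field — e.g. a one-bit piece);
* `runBitF A` — the run of the scheme `A` as a total one-bit function `⟨q, u⟩ ↦ [A.run (decScheme q) u]`
  (`runFn_mem_FP`);
* `majF A` — **the majority vote of a candidate budget**: on `⟨q, ⟨1ᶜ, ⟨1ᵏ, Z⟩⟩⟩` the bit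
  `[maj A (decScheme q) c k Z]` = `[k < 2 · #{j < k | A(decScheme q; Z[jc, jc + c)) = 1}]`
  (`majF_apply`, `majF_mem_FP`, `oneBit_majF`) — the vote of `…AdviceElimExperiment.lean` (`votes`, `maj`);
* `MParams` — the machine's polynomials (samplers' budget `c` of `n`; `Gp`, `pA`, `kp`, `Np`, `τp` of the
  length `ℓ = 2n + m + 4` of the stripped scheme word `⟨[], ⟨1ⁿ, 1ᵐ⟩⟩`), the resulting `Params`
  (`MParams.params`, `MParams.pm`) and the honest coin budget `MParams.coins` (`MParams.total_pm_le`).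

References: S. Arora, B. Barak, *Computational Complexity* (2009), §1.3 (composition, bounded loops),
Thm. 7.10 (majority vote); A. Bogdanov, L. Trevisan (2006), Def. 2.12.
-/

noncomputable section

open _root_.Computability
open Literature.Computability.Complexity Literature.Computability.Complexity.Brick
open Literature.Computability.Complexity.Plumb Literature.Computability.Complexity.HashBricks
open Literature.Computability.MetaComplexity
open Finset Polynomial

namespace Summit.PneNP.PneNP.Cruxes.PeaWorstToAvg.DualModeCompile

set_option linter.dupNamespace false -- `Summit.PneNP.PneNP.…`: summit = sub-problem name (D-0017 single-conjunct layout)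

namespace AdviceElim

/-! ### Counted sums of one-bit pieces -/

/-- The initial record of a counted sum on `x`: `⟨x, ⟨bin |kF x|, ⟨1⁰, bin 0⟩⟩⟩`. [folklore] -/
def sumInitF (kF : List Bool → List Bool) : List Bool → List Bool :=
  fanoutFn (fun w => w) (fanoutFn (lenBinF ∘ kF) (fanoutFn (fun _ => []) (fun _ => encodeNat 0)))

/-- **The counted sum** `x ↦ bin (Σ_{j < |kF x|} ⟦f ⟨x, 1ʲ⟩⟧)`: the fold `acc := acc + ⟦f ⟨x, 1ʲ⟩⟧` over
`j = 0, …, |kF x| - 1` (`p (|x|)` rounds available). [AroraBarak2009, §1.3 (bounded loops)] -/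
def sumF (f kF : List Bool → List Bool) (p : Polynomial ℕ) : List Bool → List Bool :=
  sndPow 2 ∘ foldLoop addFn f p ∘ sumInitF kF

/-- Value of the initial record. [folklore] -/
theorem sumInitF_apply (kF : List Bool → List Bool) (x : List Bool) :
    sumInitF kF x = boolPair x (boolPair (encodeNat (kF x).length) (boolPair (ones 0) (encodeNat 0))) := by
  simp [sumInitF, ones]

/-- **Value of the counted sum** (enough rounds available). [folklore] -/
theorem sumF_apply (f kF : List Bool → List Bool) {p : Polynomial ℕ} {x : List Bool}
    (hK : (kF x).length ≤ p.eval x.length) :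
    sumF f kF p x = encodeNat (∑ j ∈ range (kF x).length, bitsToNat (f (boolPair x (ones j)))) := by
  rw [sumF, Function.comp_apply, Function.comp_apply, sumInitF_apply, foldLoop_apply addFn f hK 0 _,
    sndPow_succ_boolPair, sndPow_succ_boolPair, sndPow_zero_boolPair, foldAcc_addFn]
  simp

/-- `sumInitF kF ∈ FP` for `kF ∈ FP`. [folklore] -/
theorem sumInitF_mem_FP {kF : List Bool → List Bool} (hkF : kF ∈ FP) : sumInitF kF ∈ FP :=
  fanoutFn_mem_FP OracleCompose.id_mem_FP (fanoutFn_mem_FP (comp_mem_FP lenBinF_mem_FP hkF)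
    (fanoutFn_mem_FP (const_mem_FP _) (const_mem_FP _)))

/-- **The counted sum is in `FP`** for a piece `f ∈ FP` of linear growth in its first field and a count
`kF ∈ FP`. [AroraBarak2009, §1.3 (bounded loops)] -/
theorem sumF_mem_FP {f kF : List Bool → List Bool} {C : ℕ} (hf : f ∈ FP)
    (hfg : ∀ w, (f w).length ≤ C * ((fstF w).length + 1)) (hkF : kF ∈ FP) (p : Polynomial ℕ) :
    sumF f kF p ∈ FP :=
  comp_mem_FP (sndPow_mem_FP 2) (comp_mem_FP (foldLoop_mem_FP addFn_mem_FP length_addFn_le hf hfg p)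
    (sumInitF_mem_FP hkF))

/-- A one-bit piece has linear growth with constant `1`. [folklore] -/
theorem length_le_of_oneBit {f : List Bool → List Bool} (hf : OneBit f) (w : List Bool) :
    (f w).length ≤ 1 * ((fstF w).length + 1) := by
  rw [hf.length_eq w]
  omega

/-- `bitsToNat` of a single symbol. [folklore] -/
theorem bitsToNat_singleton (b : Bool) : bitsToNat [b] = b.toNat := by
  rw [bitsToNat_cons]
  simp

/-! ### The scheme as a total one-bit function -/

variable (A : RandAlg (List Bool × ℕ × ℕ) Bool)

/-- The run of the scheme `A` as a total one-bit string function `⟨q, u⟩ ↦ [A.run (decScheme q) u]`.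
[AroraBarak2009, §1.3] -/
def runBitF : List Bool → List Bool := fun w => [A.run (decScheme (fstF w)) (sndF w)]

/-- Value of `runBitF` on a well-formed query. [folklore] -/
@[simp] theorem runBitF_boolPair (q : List Bool × ℕ × ℕ) (u : List Bool) :
    runBitF A (boolPair (schemeEnc q) u) = [A.run q u] := by
  simp [runBitF]

/-- `runBitF` is one-bit. [folklore] -/
theorem oneBit_runBitF : OneBit (runBitF A) := fun _ => ⟨_, rfl⟩

variable {A} in
/-- `runBitF A ∈ FP` for a polynomial-time scheme (`runFn_mem_FP`). [AroraBarak2009, §1.3] -/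
theorem runBitF_mem_FP (hA : A.IsPolyTime schemeEnc encodeBool) : runBitF A ∈ FP :=
  runFn_mem_FP hA

/-! ### The majority vote of a candidate budget -/

/-- On `z = ⟨⟨q, ⟨u, ⟨v, Z⟩⟩⟩, 1ʲ⟩`: the coin block `Z[j|u|, j|u| + |u|)` of run `j`. [folklore] -/
def runBlkF : List Bool → List Bool :=
  takeFn ∘ fanoutFn (nthF 1 ∘ fstF)
    (dropFn ∘ fanoutFn (umulFn ∘ fanoutFn sndF (nthF 1 ∘ fstF)) (sndPow 2 ∘ fstF))

/-- On `z = ⟨⟨q, ⟨u, ⟨v, Z⟩⟩⟩, 1ʲ⟩`: the verdict `[A.run (decScheme q) Z[j|u|, j|u| + |u|)]` of run `j`.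
[AroraBarak2009, Thm. 7.10 (proof)] -/
def runPieceF : List Bool → List Bool := runBitF A ∘ fanoutFn (fstF ∘ fstF) runBlkF

/-- The number of accepting runs, `bin votes`. [AroraBarak2009, Thm. 7.10 (proof)] -/
def votesF : List Bool → List Bool := sumF (runPieceF A) (nthF 2) X

/-- **The majority vote of a candidate**: on `⟨q, ⟨1ᶜ, ⟨1ᵏ, Z⟩⟩⟩` the bit `[k < 2 · votes]`.
[AroraBarak2009, Thm. 7.10 (proof)] -/
def majF : List Bool → List Bool :=
  ltFn ∘ fanoutFn (lenBinF ∘ nthF 2) (addFn ∘ fanoutFn (votesF A) (votesF A))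

/-- Value of `runBlkF`. [folklore] -/
theorem runBlkF_apply (q u v Z : List Bool) (j : ℕ) :
    runBlkF (boolPair (boolPair q (boolPair u (boolPair v Z))) (ones j)) = (Z.drop (j * u.length)).take u.length := by
  simp [runBlkF, umulFn_apply]

/-- Value of `runPieceF` on a well-formed query. [folklore] -/
theorem runPieceF_apply (q : List Bool × ℕ × ℕ) (u v Z : List Bool) (j : ℕ) :
    runPieceF A (boolPair (boolPair (schemeEnc q) (boolPair u (boolPair v Z))) (ones j)) =
      [A.run q ((Z.drop (j * u.length)).take u.length)] := by
  rw [runPieceF, Function.comp_apply, fanoutFn_apply, runBlkF_apply]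
  simp

/-- **Value of `votesF`**: the numeral of `votes`. [folklore] -/
theorem votesF_apply (q : List Bool × ℕ × ℕ) (c k : ℕ) (Z : List Bool) :
    votesF A (boolPair (schemeEnc q) (boolPair (ones c) (boolPair (ones k) Z))) = encodeNat (votes A q c k Z) := by
  have hK : (nthF 2 (boolPair (schemeEnc q) (boolPair (ones c) (boolPair (ones k) Z)))).length ≤
      X.eval (boolPair (schemeEnc q) (boolPair (ones c) (boolPair (ones k) Z))).length := by
    simp only [nthF_succ_boolPair, nthF_zero_boolPair, eval_X, length_boolPair, List.length_replicate]
    omega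
  rw [votesF, sumF_apply _ _ hK]
  simp only [nthF_succ_boolPair, nthF_zero_boolPair, List.length_replicate, runPieceF_apply,
    bitsToNat_singleton, votes]

/-- **Value of the majority vote**: `[maj A q c k Z]`. [AroraBarak2009, Thm. 7.10 (proof)] -/
theorem majF_apply (q : List Bool × ℕ × ℕ) (c k : ℕ) (Z : List Bool) :
    majF A (boolPair (schemeEnc q) (boolPair (ones c) (boolPair (ones k) Z))) = [maj A q c k Z] := by
  simp [majF, votesF_apply, maj, two_mul]

/-- The majority vote is one-bit on every input. [folklore] -/
theorem oneBit_majF : OneBit (majF A) := oneBit_ltFn.comp _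

variable {A}

/-- `runBlkF ∈ FP`. [folklore] -/
theorem runBlkF_mem_FP : runBlkF ∈ FP :=
  comp_mem_FP takeFn_mem_FP (fanoutFn_mem_FP (comp_mem_FP (nthF_mem_FP 1) fstF_mem_FP)
    (comp_mem_FP dropFn_mem_FP (fanoutFn_mem_FP
      (comp_mem_FP umulFn_mem_FP (fanoutFn_mem_FP sndF_mem_FP (comp_mem_FP (nthF_mem_FP 1) fstF_mem_FP)))
      (comp_mem_FP (sndPow_mem_FP 2) fstF_mem_FP))))

/-- `runPieceF A ∈ FP` for a polynomial-time scheme. [AroraBarak2009, §1.3] -/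
theorem runPieceF_mem_FP (hA : A.IsPolyTime schemeEnc encodeBool) : runPieceF A ∈ FP :=
  comp_mem_FP (runBitF_mem_FP hA) (fanoutFn_mem_FP (comp_mem_FP fstF_mem_FP fstF_mem_FP) runBlkF_mem_FP)

/-- `runPieceF A` is one-bit. [folklore] -/
theorem oneBit_runPieceF : OneBit (runPieceF A) := (oneBit_runBitF A).comp _

/-- `votesF A ∈ FP` for a polynomial-time scheme. [AroraBarak2009, §1.3 (bounded loops)] -/
theorem votesF_mem_FP (hA : A.IsPolyTime schemeEnc encodeBool) : votesF A ∈ FP :=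
  sumF_mem_FP (runPieceF_mem_FP hA) (length_le_of_oneBit oneBit_runPieceF) (nthF_mem_FP 2) X

/-- **`majF A ∈ FP`** for a polynomial-time scheme. [AroraBarak2009, Thm. 7.10 (proof)] -/
theorem majF_mem_FP (hA : A.IsPolyTime schemeEnc encodeBool) : majF A ∈ FP :=
  comp_mem_FP ltFn_mem_FP (fanoutFn_mem_FP (comp_mem_FP lenBinF_mem_FP (nthF_mem_FP 2))
    (comp_mem_FP addFn_mem_FP (fanoutFn_mem_FP (votesF_mem_FP hA) (votesF_mem_FP hA))))

/-! ### The machine's polynomials -/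

/-- The polynomials of the uniform scheme: the samplers' coin budget `c` (of `n`), the padded query length
`Gp`, the coin bound `pA` of the simulated scheme (so `P = pA (Gp ℓ)`), the repetitions `kp`, the samples
`Np` and the threshold `τp` (of the scheme-word length `ℓ`). [BogdanovTrevisan2006, Def. 2.12] -/
structure MParams where
  /-- the samplers' coin budget, a polynomial of `n` -/
  c : Polynomial ℕ
  /-- the padded query length `G(ℓ)` -/
  Gp : Polynomial ℕ
  /-- the coin bound of the simulated scheme -/
  pA : Polynomial ℕ
  /-- repetitions `k(ℓ)` -/
  kp : Polynomial ℕ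
  /-- samples per candidate `N(ℓ)` -/
  Np : Polynomial ℕ
  /-- pass threshold `τ(ℓ)` -/
  τp : Polynomial ℕ

namespace MParams

variable (mp : MParams)

/-- The largest candidate budget `P(ℓ) = pA (G ℓ)` as a polynomial. [folklore] -/
def Pp : Polynomial ℕ := mp.pA.comp mp.Gp

/-- The integer parameters at distribution parameter `n` and scheme-word length `ℓ`. [folklore] -/
def params (n ℓ : ℕ) : Params :=
  ⟨n, mp.c.eval n, mp.Gp.eval ℓ, mp.Pp.eval ℓ, mp.kp.eval ℓ, mp.Np.eval ℓ, mp.τp.eval ℓ⟩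

/-- **The honest coin budget** `(P + 1) N (1 + c + k P) + k P` as a polynomial of `ℓ`. [folklore] -/
def coins : Polynomial ℕ := (mp.Pp + 1) * mp.Np * (1 + mp.c + mp.kp * mp.Pp) + mp.kp * mp.Pp

/-- **The parameters of a run on `(y, 1ⁿ, 1ᵐ)`**: they depend on `n` and `m` only, through the length
`ℓ = |⟨[], ⟨1ⁿ, 1ᵐ⟩⟩| = 2n + m + 4` of the stripped scheme word. [folklore] -/
def pm (n m : ℕ) : Params := mp.params n (schemeEnc (([] : List Bool), n, m)).length

/-- The coins actually read are within the budget at any longer length (all polynomials are monotone).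
[folklore] -/
theorem total_le {n ℓ' ℓ : ℕ} (hn : n ≤ ℓ) (hℓ : ℓ' ≤ ℓ) : (mp.params n ℓ').total ≤ mp.coins.eval ℓ := by
  have hc : mp.c.eval n ≤ mp.c.eval ℓ := TM2Iter.eval_mono mp.c hn
  have hP : mp.Pp.eval ℓ' ≤ mp.Pp.eval ℓ := TM2Iter.eval_mono _ hℓ
  have hk : mp.kp.eval ℓ' ≤ mp.kp.eval ℓ := TM2Iter.eval_mono _ hℓ
  have hN : mp.Np.eval ℓ' ≤ mp.Np.eval ℓ := TM2Iter.eval_mono _ hℓ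
  simp only [Params.total, Params.testLen, Params.L, params, coins, eval_add, eval_mul, eval_one]
  gcongr

/-- The coins read on `(y, 1ⁿ, 1ᵐ)` are within the budget at the input length. [folklore] -/
theorem total_pm_le (y : List Bool) (n m : ℕ) : (mp.pm n m).total ≤ mp.coins.eval (schemeEnc (y, n, m)).length :=
  mp.total_le (by rw [length_schemeEnc]; omega) (by simp only [length_schemeEnc, List.length_nil]; omega)

/-- `P = pA (G)`. [folklore] -/
theorem pm_P (n m : ℕ) : (mp.pm n m).P = mp.pA.eval (mp.pm n m).G := by
  simp [pm, params, Pp, eval_comp]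

/-- The distribution parameter. [folklore] -/
@[simp] theorem pm_n (n m : ℕ) : (mp.pm n m).n = n := rfl

/-- The samplers' budget. [folklore] -/
@[simp] theorem pm_cn (n m : ℕ) : (mp.pm n m).cn = mp.c.eval n := rfl

end MParams

end AdviceElim

/-- **Registered sub-goal of this file**: the value of the majority-vote brick on a well-formed argument
(`AdviceElim.majF_apply`). [AroraBarak2009, Thm. 7.10 (proof)] -/
theorem adviceElim_majF_apply (A : RandAlg (List Bool × ℕ × ℕ) Bool) (q : List Bool × ℕ × ℕ) (c k : ℕ) (Z : List Bool) :
    AdviceElim.majF A (boolPair (schemeEnc q) (boolPair (List.replicate c true) (boolPair (List.replicate k true) Z))) =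
      [AdviceElim.maj A q c k Z] :=
  AdviceElim.majF_apply A q c k Z

end Summit.PneNP.PneNP.Cruxes.PeaWorstToAvg.DualModeCompile

end
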